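import Summits.ABC.IUTFork.Joshi.MultiplicativeStructuresJoshi
import Summits.ABC.IUTFork.Joshi.ArithTeichmullerAction
import Mathlib.RingTheory.WittVector.Teichmuller
import Mathlib.NumberTheory.Padics.PadicIntegers
import HarnessLib

/-!
# Joshi's ATS II½ §3.4–§3.5 (monoid formal group laws, the `ℤ_p`-linear and points clauses of Thm. 3.5.1) and Thm. 3.2.2 (4) from
# [KT18] — companion of E-t38's `Joshi/MultiplicativeStructuresJoshi.lean` (p432965)

Block E of the abc-iut cell (rung LADDER-ABC:A2.E; seat abc-iut-E-t13, co-typer of E-t38 on [J-2½] §3 per E-plan-2 08:22:53Z (1); E-t38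
landed §3.1–§3.5 as p432965 at 08:42Z, so this file is the COMPANION it proposed (E-t38 08:44:05Z, option (a)): the rows p432965 only
RECORDS or leaves open). SOURCE: K. Joshi, *Construction of Arithmetic Teichmüller Spaces II½: Deformations of Number Fields*,
arXiv:2305.10398**v12** (UNREFEREED; bib `Joshi2023ATS2half`; the series is rejected by the IUT author, `Mochizuki2024JoshiReport`). Locators
«p. N l. a–b» = PDF page N, lines a–b of `plan/repair/lit/renders/Joshi-arxiv-2305.10398-ATS2half/pNNNN.txt`. NO SIDE TAKEN on [IUTchIII]
Cor. 3.12, on Joshi's claims or on Mochizuki's reports; TYPED ≠ PROVED ≠ ENDORSED: printed assertions are `def … : Prop` tagged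
`@[claim "Joshi2023ATS2half" "disputed"]`, never asserted; what follows from the signature is a proved `theorem`.

CONTENT. §3.4 (p. 18 l. 28 – p. 19 l. 21): the theory of `M`-monoid formal group laws of [Joshi 2019] as a light SIGNATURE `MonoidFGLTheory`
(Mathlib has no formal group laws); the tautological `Ĝ_m(𝒪_F)`-law «`F(x,y) = x + y ∈ W(𝒪_F)⟦x,y⟧` … `a ↦ [a]·x`» realised by Mathlib's
Witt vectors: `teichmullerAction M : M →* 𝕎 𝒪_F` IS a homomorphism of multiplicative monoids (PROVED = `WittVector.teichmuller`); Thm.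
3.4.1 (universal `Ĝ_m(𝒪_F)`-law + `L → W(𝒪_F)`) as a claim-Prop; Rmk. 3.4.2 (DERIVED facts: `[a]` has `0`-th component `a`, `[1] = 1`,
`[ab] = [a][b]`). §3.5: the `ℤ_p`-LINEAR clause of Thm. 3.5.1 («isomorphism of the `ℤ_p`-modules `(𝔪_F,+) →^{AH} (1+𝔪_F,×)`») over
ABSTRACT `ℤ_p`-module structures and an abstract Artin–Hasse map (E-t38's `Thm351` is the group-level clause; Mathlib has no Artin–Hasse
exponential), with `thm351Linear_iff`; the POINTS clause («`((𝔪_F,+) − {0})/ℤ_p^* ≃ |Y_{F,ℚ_p}| ≃ ((1+𝔪_F,×) − {1})/ℤ_p^*`») over abstract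
`ℤ_p^*`-actions. §3.2 log clause: «the kernel of this homomorphism is a one dimensional `ℚ_p`-vector space» (p. 17 l. 23–24) for E-t38's
abstract `log` — PARAPHRASE (kernel ≅ `ℚ_p` as additive groups), flagged. CROSS-SEAT DERIVED ROW: E-t38's `Thm322_4` (two untilts of
`ℂ_p♭` with non-homeomorphic fields but isomorphic `K̃`) for the family of residue untilts of E-t1's `UntiltPoints` FROM E-t1's [KT18]
claim `UntiltPoints.ExistsNonIsomorphic` and E-t38's `Thm322_3` («a consequence of the first three and of … [Kedlaya and Temkin, 2018]»,
p. 18 l. 15–17). Standard axioms only; sorry-free; nothing asserted.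
-/

noncomputable section

open Set

namespace Summit.ABC.IUTFork.Joshi.ATS2half

open Summit.ABC.IUTFork.Joshi
open Summit.ABC.IUTFork.Joshi.ATS2h (IsValuedField)

variable {p : ℕ} [Fact p.Prime]

/-! ## §3.4 Monoid formal group laws [Joshi 2019] (Thm. 3.4.1, Rmk. 3.4.2) -/

/-- **The theory of `M`-monoid formal group laws of [Joshi, 2019]** as an abstract SIGNATURE (p. 18 l. 33–38: «the existence of
universal monoid formal group law, in which a multiplicative (or additive) monoid of the field is held fixed but the field structure
varies»; proof of Thm. 3.4.1 p. 19 l. 3–8: a monoid formal group law for `M` = a formal group law `F` over `R` with a «homomorphism of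
multiplicative monoids `M → End_R(F)`»): for each commutative ring `R` a type `Law R` of one-dimensional `M`-monoid formal group laws
over `R`, and pull-back along ring homomorphisms. Mathlib has no formal group laws; nothing asserted. [claim: Joshi2023ATS2half, status: disputed] -/
structure MonoidFGLTheory (M : Type) [CommMonoid M] : Type 1 where
  /-- the `M`-monoid formal group laws over `R` -/
  Law : (R : Type) → [CommRing R] → Type
  /-- pull-back of laws along a ring homomorphism `R → S` -/
  pullback : {R S : Type} → [CommRing R] → [CommRing S] → (R →+* S) → Law R → Law S

/-- **The action of the tautological `Ĝ_m(𝒪_F)`-law** (Thm. 3.4.1 p. 18 l. 42–47, proof p. 19 l. 3–8: «the tautological formal group law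
`F(x, y) = x + y ∈ W(𝒪_F)⟦x,y⟧` is a monoid formal group law for the multiplicative monoid `Ĝ_m(𝒪_F) = 1 + 𝔪_{𝒪_F}` by homomorphism of
multiplicative monoids `Ĝ_m(𝒪_F) = 1 + 𝔪_{𝒪_F} → End_{W(𝒪_F)}(F)` given by multiplication by a Teichmuller representative `a ↦ [a]·x`»): the
endomorphism «multiplication by `[a]`» of the additive law is determined by the Witt vector `[a]`, and `a ↦ [a]` IS a homomorphism of
multiplicative monoids — Mathlib's `WittVector.teichmuller`, restricted to any submonoid `M ≤ 𝒪_F` (e.g. `1 + 𝔪_F`). DEFINED.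
[claim: Joshi2023ATS2half, status: disputed] -/
def teichmullerAction (𝒪F : Type) [CommRing 𝒪F] (M : Submonoid 𝒪F) : M →* WittVector p 𝒪F :=
  (WittVector.teichmuller p).comp M.subtype

/-- **Rmk. 3.4.2 / proof of Thm. 3.4.1, DERIVED** (p. 19 l. 16–21: «For `F = ℂ_p♭`, ring `W(𝒪_F) = W(𝒪_{ℂ_p♭}) = A_inf`. The tautological formal
group law `F` … is essentially the addition law of Witt vectors»): the Teichmüller representative `[a]` has `0`-th Witt component `a`
(Mathlib `WittVector.teichmuller_coeff_zero`); multiplicativity and `[1] = 1` are the `MonoidHom` structure of `teichmullerAction`.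
[folklore] -/
theorem teichmullerAction_coeff_zero (𝒪F : Type) [CommRing 𝒪F] (M : Submonoid 𝒪F) (a : M) :
    (teichmullerAction (p := p) 𝒪F M a).coeff 0 = (a : 𝒪F) :=
  WittVector.teichmuller_coeff_zero p (a : 𝒪F)

/-- `[ab] = [a]·[b]` for the tautological action (Rmk. 3.4.2; Mathlib). [folklore] -/
theorem teichmullerAction_mul (𝒪F : Type) [CommRing 𝒪F] (M : Submonoid 𝒪F) (a b : M) :
    teichmullerAction (p := p) 𝒪F M (a * b) = teichmullerAction (p := p) 𝒪F M a * teichmullerAction (p := p) 𝒪F M b :=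
  map_mul _ a b

/-- **Thm. 3.4.1** (p. 18 l. 39 – p. 19 l. 2: «Let `F` be an algebraically closed, perfectoid field of characteristic `p > 0` … Consider the
multiplicative monoid `Ĝ_m(𝒪_F) = 1 + 𝔪_F`. Then there exists a universal one-dimensional `Ĝ_m(𝒪_F)`-formal group law `F_univ` over a
certain ring `L_{Ĝ_m(𝒪_F)}` and a ring homomorphism `L_{Ĝ_m(𝒪_F)} → W(𝒪_F)` such that the tautological `Ĝ_m(𝒪_F)`-monoid formal group law
`F(x, y) = x + y` … arises, by pull-back, via this ring homomorphism, from the universal formal group law `F_univ`»), over an abstract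
theory `T` of `M`-monoid formal group laws and a given tautological law `taut ∈ T.Law (W(𝒪_F))`: a universal pair `(L, F_univ)` (every law
over every ring is the pull-back of `F_univ` along a unique ring map) and `φ : L → W(𝒪_F)` with `φ^* F_univ = taut`. CLAIM resting on the
unrefereed [Joshi 2019]; never asserted. [claim: Joshi2023ATS2half, status: disputed] -/
@[claim "Joshi2023ATS2half" "disputed"]
def Thm341 {M : Type} [CommMonoid M] (T : MonoidFGLTheory M) (𝒪F : Type) [CommRing 𝒪F] (taut : T.Law (WittVector p 𝒪F)) : Prop :=
  ∃ (L : Type) (_ : CommRing L) (Funiv : T.Law L),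
    (∀ (R : Type) (_ : CommRing R) (F : T.Law R), ∃! ψ : L →+* R, T.pullback ψ Funiv = F) ∧
      ∃ φ : L →+* WittVector p 𝒪F, T.pullback φ Funiv = taut

/-- In a theory where pull-back along the identity is the identity, a universal law over `W(𝒪_F)` ITSELF that equals `taut` witnesses
Thm. 3.4.1 trivially — a sanity check on the shape of the claim (the content of [Joshi 2019] is the existence of `L_{Ĝ_m(𝒪_F)}` with the
universal property for ALL rings, which is the first conjunct). [folklore] -/
theorem thm341_of_universal_self {M : Type} [CommMonoid M] (T : MonoidFGLTheory M) (𝒪F : Type) [CommRing 𝒪F]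
    (taut : T.Law (WittVector p 𝒪F))
    (huniv : ∀ (R : Type) (_ : CommRing R) (F : T.Law R), ∃! ψ : WittVector p 𝒪F →+* R, T.pullback ψ taut = F)
    (hid : T.pullback (RingHom.id (WittVector p 𝒪F)) taut = taut) : Thm341 T 𝒪F taut :=
  ⟨WittVector p 𝒪F, inferInstance, taut, huniv, RingHom.id _, hid⟩

/-! ## §3.2, the kernel clause of the logarithm (p. 17 l. 20–25) -/

/-- **The kernel clause** (p. 17 l. 22–24: «`log : (1 + 𝔪_{𝒪_K})~ → K` given by `(x_n)_{n ∈ ℤ} ↦ log(x_0)` … the kernel of this homomorphism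
is a one dimensional `ℚ_p`-vector space» — [FF18 Prop. 4.5.14]), for E-t38's abstract logarithm `log : 1 + 𝔪 →* (K, +)` on its `oneUnits`:
the elements of `(1 + 𝔪)~ = tildeOneUnits` whose `0`-th coordinate has `log = 0` form a set in bijection with `ℚ_p`. PARAPHRASE of «one
dimensional `ℚ_p`-vector space» at the level of sets (E-t38's `K` carries no `ℚ_p`-structure) — flagged; CLAIM, never asserted.
[claim: Joshi2023ATS2half, status: disputed] -/
@[claim "Joshi2023ATS2half" "disputed"]
def LogKernelLine (p : ℕ) {K : Type} [Field K] {abs : K → ℝ} (hv : IsValuedField abs) (hna : IsNonarchimedeanAbs abs)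
    (log : oneUnits hv hna →* Multiplicative K) [Fact p.Prime] : Prop :=
  Nonempty ({f : tildeOneUnits p hv hna // log ⟨(f : ℕ → K) 0, ((mem_tildeOneUnits_iff p hv hna f).1 f.2).2 0⟩ = Multiplicative.ofAdd 0}
    ≃ ℚ_[p])

/-! ## §3.5 Thm. 3.5.1: the `ℤ_p`-linear clause and the points clause -/

/-- **Thm. 3.5.1, `ℤ_p`-LINEAR clause** (p. 19 l. 27–40: «one has an isomorphism of the `ℤ_p`-modules `(𝔪_F, +) →^{AH} (1 + 𝔪_F, ×)`, where
`AH` is the Artin-Hasse exponential function `AH(T) = exp(Σ_{n≥0} T^{p^n}/p^n) ∈ ℤ_p⟦T⟧`»), over ABSTRACT data: `ℤ_p`-modules `mF`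
(«`(𝔪_F,+)`») and `U1` («`(1 + 𝔪_F,×)`», written additively) and a map `ah`; the claim: `ah` is a `ℤ_p`-linear isomorphism. (E-t38's `Thm351`
is the group-level clause on its concrete `maxIdeal`/`oneUnits`; the `ℤ_p`-module structures and the Artin–Hasse series are not in
Mathlib.) CLAIM, never asserted. [claim: Joshi2023ATS2half, status: disputed] -/
@[claim "Joshi2023ATS2half" "disputed"]
def Thm351Linear (p : ℕ) [Fact p.Prime] (mF U1 : Type) [AddCommGroup mF] [Module ℤ_[p] mF] [AddCommGroup U1] [Module ℤ_[p] U1]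
    (ah : mF → U1) : Prop :=
  ∃ e : mF ≃ₗ[ℤ_[p]] U1, ∀ x, e x = ah x

/-- For a `ℤ_p`-linear `ah`, Thm. 3.5.1's linear clause IS bijectivity of `ah` (bookkeeping for the abstract typing). [folklore] -/
theorem thm351Linear_iff (mF U1 : Type) [AddCommGroup mF] [Module ℤ_[p] mF] [AddCommGroup U1] [Module ℤ_[p] U1]
    (ah : mF →ₗ[ℤ_[p]] U1) : Thm351Linear p mF U1 ah ↔ Function.Bijective ah := by
  constructor
  · rintro ⟨e, he⟩
    have : (e : mF → U1) = ah := funext he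
    rw [← this]
    exact e.bijective
  · intro h
    exact ⟨LinearEquiv.ofBijective ah h, fun _ => rfl⟩

/-- The linear clause implies E-t38-style group-level multiplicativity for the underlying map read multiplicatively: `ah (a + b) =
ah a + ah b` (additive notation for `(1 + 𝔪_F, ×)`). [folklore] -/
theorem map_add_of_thm351Linear {mF U1 : Type} [AddCommGroup mF] [Module ℤ_[p] mF] [AddCommGroup U1] [Module ℤ_[p] U1]
    {ah : mF → U1} (h : Thm351Linear p mF U1 ah) (a b : mF) : ah (a + b) = ah a + ah b := by
  obtain ⟨e, he⟩ := h
  rw [← he, ← he, ← he, map_add]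

/-- **Thm. 3.5.1, POINTS clause** (p. 19 l. 41–49: «Especially one has an additive and a multiplicative (but equivalent) descriptions of
closed classical points on `Y_{F,ℚ_p}`: `((𝔪_F, +) − {0})/ℤ_p^* ≃ |Y_{F,ℚ_p}| ≃ ((1 + 𝔪_F, ×) − {1})/ℤ_p^*`»; proof p. 19 l. 52–57: «The action
of `ℤ_p^*` is the Lubin-Tate action of `ℤ_p` on the left and … the corresponding action given explicitly in [FF18, Example 2.3.11]»),
over ABSTRACT `ℤ_p^*`-actions on the punctured carriers `mF0` («`𝔪_F − {0}`») and `U10` («`(1 + 𝔪_F) − {1}`») and a type `Y` of closed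
classical points: both orbit spaces are in bijection with `Y`. CLAIM ([FF18 2.3.10, 2.3.11, 4.4.7] as cited), never asserted.
[claim: Joshi2023ATS2half, status: disputed] -/
@[claim "Joshi2023ATS2half" "disputed"]
def PointsDescriptions (p : ℕ) [Fact p.Prime] (Y mF0 U10 : Type) [MulAction ℤ_[p]ˣ mF0] [MulAction ℤ_[p]ˣ U10] : Prop :=
  Nonempty (Y ≃ MulAction.orbitRel.Quotient ℤ_[p]ˣ mF0) ∧ Nonempty (Y ≃ MulAction.orbitRel.Quotient ℤ_[p]ˣ U10)

/-- The two descriptions are «equivalent»: under the points clause the two orbit spaces are in bijection with each other. DERIVED. [folklore] -/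
theorem orbitSpaces_equiv_of_pointsDescriptions {Y mF0 U10 : Type} [MulAction ℤ_[p]ˣ mF0] [MulAction ℤ_[p]ˣ U10]
    (h : PointsDescriptions p Y mF0 U10) :
    Nonempty (MulAction.orbitRel.Quotient ℤ_[p]ˣ mF0 ≃ MulAction.orbitRel.Quotient ℤ_[p]ˣ U10) :=
  ⟨h.1.some.symm.trans h.2.some⟩

/-! ## Thm. 3.2.2 (4) from [KT18] on E-t1's families of untilts (cross-seat DERIVED row) -/

/-- **Thm. 3.2.2 (4) DERIVED** (p. 18 l. 15–17: «The fourth is a consequence of the first three and of my central observations in [Joshi,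
2021a] regarding the consequences of the fundamental theorem of [Kedlaya and Temkin, 2018]»): on the family of residue untilts `y ↦ K_y`
of E-t1's `UntiltPoints` (points of `𝒴_{F,E}`), E-t1's [KT18] claim `ExistsNonIsomorphic` (two points with NON-homeomorphic residue fields)
and E-t38's `Thm322_3` (all `K̃_y` isomorphic) give E-t38's `Thm322_4`. (E-t1's `TopIso` = a field isomorphism continuous with
continuous inverse — exactly the homeomorphism negated in `Thm322_4`.) [folklore] -/
theorem thm322_4_of_existsNonIsomorphic {𝒪E : Type} [CommRing 𝒪E] (D : UntiltPoints p 𝒪E) (hKT : D.ExistsNonIsomorphic)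
    (h3 : Thm322_3 (fun y : D.Pt => (D.untilt y).K) p) : Thm322_4 (fun y : D.Pt => (D.untilt y).K) p := by
  obtain ⟨y₁, y₂, hne⟩ := hKT
  refine ⟨y₁, y₂, ?_, ⟨(h3 y₁ y₂).some.toMulEquiv⟩⟩
  rintro ⟨e, he, he'⟩
  exact hne ⟨⟨e, he, he'⟩⟩

/-- Hence, on such a family, E-t38's `Cor331` (Cor. 3.3.1: «multiplicative structure fixed while the topological structure varies»)
follows from `Thm322_1` and [KT18]. DERIVED. [folklore] -/
theorem cor331_of_existsNonIsomorphic {𝒪E : Type} [CommRing 𝒪E] (D : UntiltPoints p 𝒪E) (hKT : D.ExistsNonIsomorphic)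
    (F : Type) [Field F] [TopologicalSpace F] (h1 : Thm322_1 (fun y : D.Pt => (D.untilt y).K) F p) :
    Cor331 (fun y : D.Pt => (D.untilt y).K) p :=
  cor331_of _ F p h1 (thm322_4_of_existsNonIsomorphic D hKT (thm322_3_of_1 _ F p h1))

end Summit.ABC.IUTFork.Joshi.ATS2half

end
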